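/-
Copyright (c) 2026 the pub-hodgecm-mathlib formalisation cell (harness21).  Prover seat hodgecm-mathlib-LH4-p11 (g4), req620 Track A «(D-RAM) FOUR-FRAME» squad: the
«DEEP-THRESHOLD BRIDGE» — REF5 (g23) R5-142's kernel-checked model-reader recipe (scratch `DeepBridge` 55750ffa ∕ `DeltaAnyThreshold` 882fb0b6, judge-only seat, filed nowhere)
lifted into `Theorems/` with the threshold-antitonicity plumbing its tier-0 consumer needs.  2026-09-04.
-/
import Summits.HodgeConjecture.HodgeConjecture.Theorems.F0P3cDyRamKappaSignLawR2OfRecord              -- ★ p857042 (LH4-p10 (g3)): `exists_slot_data`, `v_sub_one_le_of_relDepth`; brings ★ p857007 bridge, ★ №1-R2 ∕ №1-R ∕ №1 law defs, ★ ΩR, ★ p856992 `glueSign_eq_one_of_v_sub_one_le`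
import Summits.HodgeConjecture.HodgeConjecture.Theorems.F0P3cDyRamFourFrameTransferFactorShiftIndep    -- ★ (LH4-p12 (g4)): `fourFrameTransferFactorS_indep`; brings ★ №2c-R (`FourFrameTransferFactorS`, `…_shiftT_iff`), ★ p854932, ★ U1-3 p854865, ★ U1-4 p855010
import HarnessLib

/-!
# Crux `H413`, line LH4 «(D-RAM) FOUR-FRAME» road — THE DEEP-THRESHOLD BRIDGE: the inputs of the law socket ★ #11S `anchorRows_of_fourFrameLawsS` AT THE RAISED THRESHOLD
# `N₀' d' := max (depthOfRecord d') (2 d' − 1 + t)`, from the units' exports at the depth of record — at EVERY wild place, covered or not, with no `Ω` in any socket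

Cell `hodgecm-mathlib` (D-0151), FLOOR 0, crux item H413 = `stmt-HodgeConjecture-24833`, route of record `HCCMUnconditional`; squad F0∕P3c∕LH4 (req618∕req620); helper lane
`--supports stmt-HodgeConjecture-24833 --as helper` (count-neutral).  THEOREMS ONLY (no `def`, no instance, no notation, no `sorry`, default heartbeats).  Consumer: the
tier-0 `stub_rows_unit0 : PieceRowsWild gselStar 0` payer (tier-0 line `Cruxes/H413/Lines/F0_P3c_DyRamFourFrame.lean`), row (1) through ★ #11S.

THE QUESTION (LH4-p11 (g4) 03:40Z offer (b), REF5 (g23) R5-141 rider).  Unit U3 closed (ED. 15 e5c2ce7e) on the Ω-AWARE κ-sign law `KappaSignLawAtR2 omegaR depthOfRecord tauOfRecord`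
((R-22) «κS-RECUT»): the sign token of slot `i` carries `omegaR … i = Ω((b, a, b∕a)_i)`, the norm class of a `σ`-fixed representative of the slot's symmetric unit modulo
`U_E^{(2d−1)}`.  The law socket ★ #11S consumes ★ №1-R's Ω-free cut `KappaSignLawAtS shift N₀ τ`, and the ★ covered-set bridge (p857007 ∕ p857042) returns that currency only
on `d % 2 = 1 ∨ 2d ≤ t + 2`; but UNCOVERED wild places (`d` even, `e_F + 2 ≤ d ≤ t = 2e_F`, e.g. the e2b cell `(d, t) = (4, 4)`) occur inside Hyp413's `∀` (ref1 R1-630a: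
`L = ℚ(√−2, √3, √17)`), and there `Ω = −1` is READ on live axes at the threshold of record.

THE ANSWER (REF5 R5-142 (2)): no Ω-aware socket is needed.  Every law ∕ dictionary ★ #11S consumes binds the near-identity THRESHOLD SCHEDULE `N₀ : ℕ → ℕ` after the place datum
`(d, t)`, and `N₀` enters each of them exactly once, as the `IsElementDatum … (N₀ d) …` binder — in HYPOTHESIS position, so every cut is ANTITONE in the threshold (§1: a larger
threshold only removes rows).  At the RAISED threshold `2d − 1 + t ≤ N₀ d` every read row has `n_i ≥ 2d − 1 + t`, so by the relative-depth identity `|c_i − 1|·|ϖ|^t = |ϖ|^{n_i}`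
(★ `exists_slot_data`) the symmetric unit satisfies `|c_i − 1| ≤ |ϖ|^{2d−1}`: `u = 1` IS a glue representative and `Ω ≡ 1` (§2, ★ `glueSign_eq_one_of_v_sub_one_le`) — AT EVERY
WILD PLACE, covered or not (the odd-`d` branch of ★ `omegaR_eq_one_or_ampl_eq_zero_of_covered` with the parity hypothesis deleted).  Hence (§3) at the raised threshold the
Ω-aware cut IS ★ №1-R's cut, and U3's export `FourFrameLawsWildOfRecordR2 omegaR` delivers ★ №1-R's fenced conjunction `FourFrameLawsWildAtR N₀' tauOfRecord` with
`N₀' d' := max (depthOfRecord d') (2 d' − 1 + t)` — a legal `ℕ → ℕ` schedule once the place's `t` is fixed.  The dictionary (D-CΔ) is ★ at ANY threshold (§4: ★ U1-3 ∕ U1-4 ∕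
p854932 are generic in `N₀`).  The `∃ V ∈ 𝓝 1` of `PieceRowsWild` absorbs the deeper threshold (#11S builds `V := V_H ∩ V_Δ`).  BY-PRODUCT (R5-142, numbers): the `Ω = −1`
flip window is the thin shell `n_i ∈ [max(3d−2, 2t+2), 2d+t−2]`, empty iff `2d ≤ t + 2` — invisible to any consumer that needs the laws in SOME neighbourhood of `1`.

WHAT IS PROVED.
* §1 `isElementDatum_of_le`, `stableLawAt_of_le`, `kappaAmplitudeLawAtS_of_le`, `kappaSignLawAtS_of_le`, `kappaSignLawAtS2_of_le`, `fourFrameLawsWildAtR_of_le`,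
  `fourFrameLawsWildAtR2_of_le` — THRESHOLD ANTITONICITY of every cut and of the fenced conjunctions (pointwise in `d`: `N₀ d ≤ N₀' d`).
* §2 `omegaR_eq_one_of_deep` — `2d − 1 + t ≤ N₀ ⇒ omegaR K σ ϖ d a b i = 1` on every admissible row (any `d`, any `t`).
* §3 `kappaSignLawAtR2_omegaR_iff_kappaSignLawAtR_of_deep`, `fourFrameLawsWildAtR2_omegaR_iff_fourFrameLawsWildAtR_of_deep` (★ p857007 fed `Or.inl`);
  `kappaSignLawAtR_deep_of_recordR2`, `fourFrameLawsWildAtR_deep_of_recordR2` (one datum) and `fourFrameLawsWildAtR_deep_of_ofRecordR2` (from the CLOSED Prop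
  `FourFrameLawsWildOfRecordR2 omegaR` — U3 ED. 15's export `u3_fourFrameLawsWildOfRecordR2`, taken as a hypothesis since `Theorems/` does not import `Lines/`).
* §4 `fourFrameTransferFactor_any`, `fourFrameTransferFactorS_any` — (D-CΔ) ∕ (D-CΔ)-S at ANY threshold schedule (and any shift).
HONEST LABEL.  Count-neutral (`--supports`): plumbing + one valuation estimate over ★ leaves; nothing asserted about the census laws themselves (prover targets, paid in U3 by
★ files); the (D-H) input at the raised threshold (antitone in `N₀` likewise — row (1)'s `IsElementDatum` binder is in hypothesis position) is a sibling file; `HC_CM` is proved only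
modulo the 7 printed citations (2 remaining named inputs: hLiu418 = `stmt-HodgeConjecture-24832`, h413 = `stmt-HodgeConjecture-24833`) until rung 0 closes.

## References
* [Rogawski1990] J. D. Rogawski, *Automorphic Representations of Unitary Groups in Three Variables*, Ann. of Math. Stud. 123 (1990), §4.9 Prop. 4.9.1 (a) p. 55, §4.10 p. 58.
* [LanglandsShelstad1987] R. P. Langlands, D. Shelstad, *On the definition of transfer factors*, Math. Ann. 278 (1987), §1.3, §3.
* [Serre1979] J.-P. Serre, *Local Fields*, GTM 67 (1979), Ch. V §3 Prop. 5, Cor. 3 (norm groups of ramified quadratic extensions; `U_F^{(d)} ⊆ N(E^×)`).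
-/

set_option autoImplicit false

noncomputable section

namespace Summit.HodgeConjecture.HodgeConjecture.Cruxes.H413.F0P3cDyRamFourFrameLawsDeepThreshold

open WithZero
open scoped Valued WithZero Matrix MatrixGroups
open Literature.NumberTheory.Automorphic Literature.NumberTheory.Automorphic.HermitianLattice
open Literature.NumberTheory.Automorphic.UnitaryLatticeTree Literature.NumberTheory.Automorphic.UnitaryThreeFourFrame
open Summit.HodgeConjecture.HodgeConjecture.Cruxes.H413.F0P3cDyRamFourFrameLawDefs
open Summit.HodgeConjecture.HodgeConjecture.Cruxes.H413.F0P3cDyRamFourFrameLawDefsR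
open Summit.HodgeConjecture.HodgeConjecture.Cruxes.H413.F0P3cDyRamFourFrameLawDefsR2
open Summit.HodgeConjecture.HodgeConjecture.Cruxes.H413.F0P3cDyRamKappaSignLawR2Bridge
open Summit.HodgeConjecture.HodgeConjecture.Cruxes.H413.F0P3cDyRamOmegaRDefs
open Summit.HodgeConjecture.HodgeConjecture.Cruxes.H413.F0P3cDyRamDiagonalGlueSignDefs
open Summit.HodgeConjecture.HodgeConjecture.Cruxes.H413.F0P3cDyRamDiagonalGlueSignEval
open Summit.HodgeConjecture.HodgeConjecture.Cruxes.H413.F0P3cDyRamKappaSignLawR2OfRecord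
open Summit.HodgeConjecture.HodgeConjecture.Cruxes.H413.F0P3cDyRamFourFrameHSideDefs
open Summit.HodgeConjecture.HodgeConjecture.Cruxes.H413.F0P3cDyRamFourFrameHSideDefsR
open Summit.HodgeConjecture.HodgeConjecture.Cruxes.H413.F0P3cDyRamFourFrameTransferFactorShiftIndep

variable {K : Type} [Field K] [Valued K ℤᵐ⁰]

/-! ## §1  THRESHOLD ANTITONICITY: a larger near-identity threshold only removes rows -/

/-- An element datum at threshold `N'` is an element datum at every smaller threshold `N ≤ N'` (the threshold only bounds the root depths from below).
[cite: Rogawski1990, §4.9 p. 55] -/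
theorem isElementDatum_of_le {σ : K →+* K} {ϖ : K} {N N' : ℕ} (hle : N ≤ N') {α β : K} {n₁ n₂ n₃ : ℕ}
    (hE : IsElementDatum σ ϖ N' α β n₁ n₂ n₃) : IsElementDatum σ ϖ N α β n₁ n₂ n₃ := by
  obtain ⟨h1, h2, h3, h4, h5, h6, h7, h8, hN1, hN2, hN3⟩ := hE
  exact ⟨h1, h2, h3, h4, h5, h6, h7, h8, hle.trans hN1, hle.trans hN2, hle.trans hN3⟩

/-- (S)At is ANTITONE in the threshold at `d`. [cite: Rogawski1990, §4.9 Prop. 4.9.1 (b) p. 55] -/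
theorem stableLawAt_of_le [CompleteSpace K] [Fintype 𝓀[K]] {N₀ N₀' : ℕ → ℕ} (σ : K →+* K) (ϖ : K) {d t : ℕ} (hle : N₀ d ≤ N₀' d)
    (h : StableLawAt N₀ σ ϖ d t) : StableLawAt N₀' σ ϖ d t :=
  fun hD f hf α β n₁ n₂ n₃ hE => h hD f hf α β n₁ n₂ n₃ (isElementDatum_of_le hle hE)

/-- (K-ABS-S)At is ANTITONE in the threshold at `d` (any shift). [cite: Rogawski1990, §4.9 Prop. 4.9.1 (a) p. 55] -/
theorem kappaAmplitudeLawAtS_of_le [CompleteSpace K] [Fintype 𝓀[K]] (shift : ℕ → ℕ → ℤ) {N₀ N₀' : ℕ → ℕ} (τ : ℕ → ℤ) (σ : K →+* K) (ϖ : K) {d t : ℕ}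
    (hle : N₀ d ≤ N₀' d) (h : KappaAmplitudeLawAtS shift N₀ τ σ ϖ d t) : KappaAmplitudeLawAtS shift N₀' τ σ ϖ d t :=
  fun hD f hf α β n₁ n₂ n₃ hE => h hD f hf α β n₁ n₂ n₃ (isElementDatum_of_le hle hE)

/-- (K-SGN-S)At is ANTITONE in the threshold at `d` (any shift). [cite: Rogawski1990, §4.9 Prop. 4.9.1 (a) p. 55] -/
theorem kappaSignLawAtS_of_le [CompleteSpace K] [Fintype 𝓀[K]] (shift : ℕ → ℕ → ℤ) {N₀ N₀' : ℕ → ℕ} (τ : ℕ → ℤ) (σ : K →+* K) (ϖ : K) {d t : ℕ}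
    (hle : N₀ d ≤ N₀' d) (h : KappaSignLawAtS shift N₀ τ σ ϖ d t) : KappaSignLawAtS shift N₀' τ σ ϖ d t :=
  fun hD f hf δ hδ hδ0 a b ha hb ha1 hb1 n₁ n₂ n₃ hE => h hD f hf δ hδ hδ0 a b ha hb ha1 hb1 n₁ n₂ n₃ (isElementDatum_of_le hle hE)

/-- (K-SGN-S2)At (Ω-aware, any token schedule, any shift) is ANTITONE in the threshold at `d`. [cite: Rogawski1990, §4.9 Prop. 4.9.1 (a) p. 55] [cite: LanglandsShelstad1987, §1.3] -/
theorem kappaSignLawAtS2_of_le [CompleteSpace K] [Fintype 𝓀[K]] (shift : ℕ → ℕ → ℤ) (Ω : OmegaSchedule) {N₀ N₀' : ℕ → ℕ} (τ : ℕ → ℤ) (σ : K →+* K) (ϖ : K) {d t : ℕ}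
    (hle : N₀ d ≤ N₀' d) (h : KappaSignLawAtS2 shift Ω N₀ τ σ ϖ d t) : KappaSignLawAtS2 shift Ω N₀' τ σ ϖ d t :=
  fun hD f hf δ hδ hδ0 a b ha hb ha1 hb1 n₁ n₂ n₃ hE => h hD f hf δ hδ hδ0 a b ha hb ha1 hb1 n₁ n₂ n₃ (isElementDatum_of_le hle hE)

/-- ★ №1-R's fenced conjunction `FourFrameLawsWildAtR N₀ τ` is ANTITONE in the threshold at `d`. [cite: Rogawski1990, §4.9 Prop. 4.9.1 p. 55] -/
theorem fourFrameLawsWildAtR_of_le [CompleteSpace K] [Fintype 𝓀[K]] {N₀ N₀' : ℕ → ℕ} (τ : ℕ → ℤ) (σ : K →+* K) (ϖ : K) {d t : ℕ} (hle : N₀ d ≤ N₀' d)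
    (h : FourFrameLawsWildAtR N₀ τ σ ϖ d t) : FourFrameLawsWildAtR N₀' τ σ ϖ d t := by
  intro h2
  obtain ⟨hS, hKA, hKS⟩ := h h2
  exact ⟨stableLawAt_of_le σ ϖ hle hS, kappaAmplitudeLawAtS_of_le shiftR τ σ ϖ hle hKA, kappaSignLawAtS_of_le shiftR τ σ ϖ hle hKS⟩

/-- The Ω-aware fenced conjunction `FourFrameLawsWildAtR2 Ω N₀ τ` is ANTITONE in the threshold at `d`. [cite: Rogawski1990, §4.9 Prop. 4.9.1 p. 55] [cite: LanglandsShelstad1987, §1.3] -/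
theorem fourFrameLawsWildAtR2_of_le [CompleteSpace K] [Fintype 𝓀[K]] (Ω : OmegaSchedule) {N₀ N₀' : ℕ → ℕ} (τ : ℕ → ℤ) (σ : K →+* K) (ϖ : K) {d t : ℕ} (hle : N₀ d ≤ N₀' d)
    (h : FourFrameLawsWildAtR2 Ω N₀ τ σ ϖ d t) : FourFrameLawsWildAtR2 Ω N₀' τ σ ϖ d t := by
  intro h2
  obtain ⟨hS, hKA, hKS⟩ := h h2
  exact ⟨stableLawAt_of_le σ ϖ hle hS, kappaAmplitudeLawAtS_of_le shiftR τ σ ϖ hle hKA, kappaSignLawAtS2_of_le shiftR Ω τ σ ϖ hle hKS⟩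

/-! ## §2  `Ω ≡ 1` AT THE DEEP THRESHOLD `2d − 1 + t ≤ N₀`, covered or not (REF5 (g23) R5-142) -/

/-- **DEEP DISCHARGE.**  At ANY ramified quadratic datum `(σ, ϖ; d, t)`, if the element datum of the squares `(a², b²; n₁, n₂, n₃)` sits at a threshold `N₀ ≥ 2d − 1 + t` (roots `a, b ∈ E¹`
under the root guard), then `omegaR K σ ϖ d a b i = 1` for every slot: the slot's symmetric unit `c_i ∈ {b, a, b∕a}` has `|c_i − 1|·|ϖ|^t = |ϖ|^{n_i}` with `n_i ≥ N₀ ≥ 2d − 1 + t`,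
so `|c_i − 1| ≤ |ϖ|^{2d−1}` and `u = 1` represents it (★ `glueSign_eq_one_of_v_sub_one_le`). [cite: Serre1979, Ch. V §3 Prop. 5, Cor. 3] [cite: Rogawski1990, §4.10 p. 58] -/
theorem omegaR_eq_one_of_deep [CompleteSpace K] [Fintype 𝓀[K]] {σ : K →+* K} {ϖ : K} {d t : ℕ} (hD : IsRamifiedQuadraticDatum σ ϖ d t)
    {N₀ : ℕ} (hN : 2 * d - 1 + t ≤ N₀) {a b : K} (ha : a * σ a = 1)
    (hga : Valued.v (a - 1) < Valued.v (2 : K)) (hgb : Valued.v (b - 1) < Valued.v (2 : K))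
    {n₁ n₂ n₃ : ℕ} (hE : IsElementDatum σ ϖ N₀ (a * a) (b * b) n₁ n₂ n₃) (i : Fin 3) :
    omegaR K σ ϖ d a b i = 1 := by
  obtain ⟨c, n, hci, hni, -, hrel⟩ := exists_slot_data hD ha hga hgb hE i
  obtain ⟨-, -, -, -, -, -, -, -, hN1, hN2, hN3⟩ := hE
  have hle : (N₀ : ℤ) ≤ (n : ℤ) := by
    rw [← hni]; fin_cases i <;> simp <;> omega
  have hn : (2 * d - 1) + t ≤ n := by omega
  rw [hci]
  exact glueSign_eq_one_of_v_sub_one_le hD (v_sub_one_le_of_relDepth hD.2.2.1 hrel hn)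

/-! ## §3  THE BRIDGE AT THE DEEP THRESHOLD: the Ω-aware cut of record IS ★ №1-R's cut; U3's export in ★ №1-R's currency at `N₀' d' := max (depthOfRecord d') (2 d' − 1 + t)` -/

/-- **DEEP BRIDGE (κ-sign cut).**  At a datum whose threshold satisfies `2d − 1 + t ≤ N₀ d`: `KappaSignLawAtR2 omegaR N₀ tauOfRecord σ ϖ d t ↔ KappaSignLawAtR N₀ tauOfRecord σ ϖ d t`
— covered or not (★ p857007 fed with `Or.inl` from §2). [cite: LanglandsShelstad1987, §1.3] [cite: Rogawski1990, §4.9 Prop. 4.9.1 (a) p. 55] -/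
theorem kappaSignLawAtR2_omegaR_iff_kappaSignLawAtR_of_deep [CompleteSpace K] [Fintype 𝓀[K]] (N₀ : ℕ → ℕ) (σ : K →+* K) (ϖ : K) {d t : ℕ}
    (hN : 2 * d - 1 + t ≤ N₀ d) :
    KappaSignLawAtR2 omegaR N₀ tauOfRecord σ ϖ d t ↔ KappaSignLawAtR N₀ tauOfRecord σ ϖ d t :=
  kappaSignLawAtR2_iff_kappaSignLawAtR_of_forall_eq_one_or_ampl_eq_zero omegaR N₀ tauOfRecord σ ϖ d t
    fun _ _ _ _ _ _ _ i _ hD _ _ ha _ ha1 hb1 hE _ _ => Or.inl (omegaR_eq_one_of_deep hD hN ha ha1 hb1 hE i)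

/-- **DEEP BRIDGE (fenced conjunction).**  At a datum whose threshold satisfies `2d − 1 + t ≤ N₀ d`:
`FourFrameLawsWildAtR2 omegaR N₀ tauOfRecord σ ϖ d t ↔ FourFrameLawsWildAtR N₀ tauOfRecord σ ϖ d t`. [cite: LanglandsShelstad1987, §1.3] [cite: Rogawski1990, §4.9 Prop. 4.9.1 (a) p. 55] -/
theorem fourFrameLawsWildAtR2_omegaR_iff_fourFrameLawsWildAtR_of_deep [CompleteSpace K] [Fintype 𝓀[K]] (N₀ : ℕ → ℕ) (σ : K →+* K) (ϖ : K) {d t : ℕ}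
    (hN : 2 * d - 1 + t ≤ N₀ d) :
    FourFrameLawsWildAtR2 omegaR N₀ tauOfRecord σ ϖ d t ↔ FourFrameLawsWildAtR N₀ tauOfRecord σ ϖ d t :=
  fourFrameLawsWildAtR2_iff_fourFrameLawsWildAtR_of_forall_eq_one_or_ampl_eq_zero omegaR N₀ tauOfRecord σ ϖ d t
    fun _ _ _ _ _ _ _ i _ hD _ _ ha _ ha1 hb1 hE _ _ => Or.inl (omegaR_eq_one_of_deep hD hN ha ha1 hb1 hE i)

/-- **THE RECIPE, κ-SIGN CUT.**  From the Ω-aware cut at the parameters of record `(depthOfRecord, tauOfRecord)` (the currency of U3's ED. 15 export) to ★ №1-R's cut at the RAISED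
threshold `N₀' d' := max (depthOfRecord d') (2 d' − 1 + t)` — at every wild place, with no covered-set guard. [cite: LanglandsShelstad1987, §1.3] [cite: Rogawski1990, §4.9 Prop. 4.9.1 (a) p. 55] -/
theorem kappaSignLawAtR_deep_of_recordR2 [CompleteSpace K] [Fintype 𝓀[K]] (σ : K →+* K) (ϖ : K) (d t : ℕ)
    (h : KappaSignLawAtR2 omegaR depthOfRecord tauOfRecord σ ϖ d t) :
    KappaSignLawAtR (fun d' => max (depthOfRecord d') (2 * d' - 1 + t)) tauOfRecord σ ϖ d t :=
  (kappaSignLawAtR2_omegaR_iff_kappaSignLawAtR_of_deep _ σ ϖ (le_max_right _ _)).1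
    (kappaSignLawAtS2_of_le shiftR omegaR tauOfRecord σ ϖ (le_max_left _ _) h)

/-- **THE RECIPE, FENCED CONJUNCTION (one datum).**  `FourFrameLawsWildAtR2 omegaR depthOfRecord tauOfRecord σ ϖ d t → FourFrameLawsWildAtR N₀' tauOfRecord σ ϖ d t`,
`N₀' d' := max (depthOfRecord d') (2 d' − 1 + t)` — the `hS ∕ hKA ∕ hKS` inputs of ★ #11S `anchorRows_of_fourFrameLawsS shiftR` at the raised threshold, from U3's currency.
[cite: LanglandsShelstad1987, §1.3] [cite: Rogawski1990, §4.9 Prop. 4.9.1 (a) p. 55] -/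
theorem fourFrameLawsWildAtR_deep_of_recordR2 [CompleteSpace K] [Fintype 𝓀[K]] (σ : K →+* K) (ϖ : K) (d t : ℕ)
    (h : FourFrameLawsWildAtR2 omegaR depthOfRecord tauOfRecord σ ϖ d t) :
    FourFrameLawsWildAtR (fun d' => max (depthOfRecord d') (2 * d' - 1 + t)) tauOfRecord σ ϖ d t :=
  (fourFrameLawsWildAtR2_omegaR_iff_fourFrameLawsWildAtR_of_deep _ σ ϖ (le_max_right _ _)).1
    (fourFrameLawsWildAtR2_of_le omegaR tauOfRecord σ ϖ (le_max_left _ _) h)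

/-- **THE RECIPE FROM U3's CLOSED EXPORT.**  Given the closed Prop `FourFrameLawsWildOfRecordR2 omegaR` (tier-1 unit U3 ED. 15 `u3_fourFrameLawsWildOfRecordR2`, kernel-closed on the
trio), at EVERY complete datum with finite residue field: ★ №1-R's fenced laws `(S)At ∧ (K-ABS-R)At ∧ (K-SGN-R)At` hold at the raised threshold `N₀' d' := max (depthOfRecord d') (2 d' − 1 + t)`.
[cite: LanglandsShelstad1987, §1.3] [cite: Rogawski1990, §4.9 Prop. 4.9.1 (a) p. 55] -/
theorem fourFrameLawsWildAtR_deep_of_ofRecordR2 (h : FourFrameLawsWildOfRecordR2 omegaR)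
    {K : Type} [Field K] [Valued K ℤᵐ⁰] [CompleteSpace K] [Fintype 𝓀[K]] (σ : K →+* K) (ϖ : K) (d t : ℕ) :
    FourFrameLawsWildAtR (fun d' => max (depthOfRecord d') (2 * d' - 1 + t)) tauOfRecord σ ϖ d t :=
  fourFrameLawsWildAtR_deep_of_recordR2 σ ϖ d t ((fourFrameLawsWildOfRecordR2_iff omegaR).1 h σ ϖ d t)

/-- **UNFENCED FORM at a wild place** (`|2| < 1`): from U3's closed export, the three ★ №1-R cuts at the raised threshold, as the separate hypotheses `_hS ∕ _hKA ∕ hKS` of ★ #11S.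
[cite: LanglandsShelstad1987, §1.3] [cite: Rogawski1990, §4.9 Prop. 4.9.1 (a) p. 55] -/
theorem lawsAtR_deep_of_ofRecordR2 (h : FourFrameLawsWildOfRecordR2 omegaR)
    {K : Type} [Field K] [Valued K ℤᵐ⁰] [CompleteSpace K] [Fintype 𝓀[K]] (σ : K →+* K) (ϖ : K) (d t : ℕ) (h2 : Valued.v (2 : K) < 1) :
    StableLawAt (fun d' => max (depthOfRecord d') (2 * d' - 1 + t)) σ ϖ d t ∧
      KappaAmplitudeLawAtS shiftR (fun d' => max (depthOfRecord d') (2 * d' - 1 + t)) tauOfRecord σ ϖ d t ∧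
      KappaSignLawAtS shiftR (fun d' => max (depthOfRecord d') (2 * d' - 1 + t)) tauOfRecord σ ϖ d t :=
  fourFrameLawsWildAtR_deep_of_ofRecordR2 h σ ϖ d t h2

/-! ## §4  (D-CΔ) AT ANY THRESHOLD SCHEDULE (REF5 (g23) `DeltaAnyThreshold`): the ★ pieces are generic in `N₀` -/

/-- **(D-CΔ) `FourFrameTransferFactor N₀` at ANY threshold schedule** — ★ p854932 `fourFrameTransferFactor_of N₀` over ★ U1-3 `fourFrameData N₀` and ★ U1-4 `normPairs_iff_frames N₀`
(★ `fourFrameTransferFactor_depthOfRecord` is the case `N₀ := depthOfRecord`). [cite: Rogawski1990, §4.3 (4.3.2) p. 43; §4.9 Prop. 4.9.1 p. 55] [cite: LanglandsShelstad1987, §3] -/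
theorem fourFrameTransferFactor_any (N₀ : ℕ → ℕ) : FourFrameTransferFactor N₀ :=
  F0P3cDyRamTransferFactorTypeOne.fourFrameTransferFactor_of N₀ (F0P3cDyRamFourFrameData.fourFrameData N₀)
    (F0P3cDyRamNormPairsIffFrames.normPairs_iff_frames N₀)

/-- **(D-CΔ)-S `FourFrameTransferFactorS shift N₀` at ANY shift and ANY threshold** — the `hDΔ` input of ★ #11S `anchorRows_of_fourFrameLawsS shift` at a raised threshold
(★ `fourFrameTransferFactorS_indep` from `shiftT`). [cite: Rogawski1990, §4.9 Prop. 4.9.1 p. 55] [cite: LanglandsShelstad1987, §3] -/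
theorem fourFrameTransferFactorS_any (shift : ℕ → ℕ → ℤ) (N₀ : ℕ → ℕ) : FourFrameTransferFactorS shift N₀ :=
  fourFrameTransferFactorS_indep shiftT shift N₀ ((fourFrameTransferFactorS_shiftT_iff N₀).2 (fourFrameTransferFactor_any N₀))

end Summit.HodgeConjecture.HodgeConjecture.Cruxes.H413.F0P3cDyRamFourFrameLawsDeepThreshold

end
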